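import Summits.KontsevichZagierPeriods.KontsevichZagierPeriods.Theorems.HurwitzMicroSectorsNormalFormPrincipleM2FiveZetaTwo

/-!
# `NormalFormPrinciple` (stmt-KontsevichZagierPeriods-3869), line `SketchIdeator1` — leaf `stub_boxRigidity`:
# the cyclotomic log layer: the cyclotomic kit

Registered sub-goal `cyclo_kit` of the cyclotomic log layer (lead file `…CycloLog`). For the edge
`F(x) = ∏_{d<n} G_{d+1}(x)^{a d} · H_{d+1}(x)^{b d}` with `G_{d+1}(x) = 1 + x + ⋯ + x^d` and
`H_{d+1}(x) = 1/(1 − x^{d+1})` we prove: (1) `F` is `ℚ`-semialgebraic on `σ = (0,1) ⊆ ℝ¹` — it is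
the quotient of the `ℚ`-polynomials `∏ G_{d+1}^{a d}` and `∏ (1 − x^{d+1})^{b d}`, the latter
non-vanishing on `σ`; (2) `F ≥ 1` on `(0,1)` — every factor is `≥ 1`; (3) `(c/x) log F` is
absolutely integrable on `(0,1)` for every real `c`: on `(0,1)` one has
`log G_{d+1} = log (1/(1−x)) − log (1/(1−x^{d+1}))` (from `G_{d+1} · (1 − x) = 1 − x^{d+1}`) and
`log H_{d+1} = log (1/(1−x^{d+1}))`, so `(c/x) log F` agrees on `(0,1)` with a finite
`ℕ`-combination of the integrable functions `(c/x) log (1/(1−xᵏ))`, `k ≥ 1` (conjunct 5 of the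
landed `integrable_logs`). Pure Mathlib real analysis plus the semialgebraic-function API of the
Literature layer; no new definitions.
References: M. Kontsevich, D. Zagier, *Periods* (2001), §1.2.
-/

noncomputable section

open MeasureTheory Set
open Literature.NumberTheory.Transcendental Literature.NumberTheory.Transcendental.KZ
open Literature.ModelTheory.ExponentialFields (IsSemialgebraic)

namespace Summit.KontsevichZagierPeriods.HurwitzMicroSectors.NormalFormPrinciple.PiBox.M2

/-! ## Semialgebraicity of the cyclotomic edge -/

/-- The cyclotomic edge `F = ∏_{d<n} G_{d+1}^{a d} H_{d+1}^{b d}` is `ℚ`-semialgebraic on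
`σ = (0,1) ⊆ ℝ¹`: it is the quotient of the `ℚ`-polynomials `∏ (∑_{i≤d} xⁱ)^{a d}` and
`∏ (1 − x^{d+1})^{b d}`, whose denominator does not vanish on `σ`
(`isSemialgebraicFunOn_aeval_div_aeval`). [folklore] -/
private theorem isSemialgebraicFunOn_cycloEdge (n : ℕ) (a b : ℕ → ℕ) :
    IsSemialgebraicFunOn ℚ {y : Fin 1 → ℝ | 0 < y 0 ∧ y 0 < 1}
      (fun y => (fun x : ℝ => ∏ d ∈ Finset.range n,
        (∑ i ∈ Finset.range (d + 1), x ^ i) ^ (a d) * (1 / (1 - x ^ (d + 1))) ^ (b d)) (y 0)) := by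
  refine (isSemialgebraicFunOn_aeval_div_aeval isSemialgebraic_unitInterval_fin_one
    (∏ d ∈ Finset.range n, (∑ i ∈ Finset.range (d + 1), MvPolynomial.X 0 ^ i) ^ (a d) :
      MvPolynomial (Fin 1) ℚ)
    (∏ d ∈ Finset.range n, (1 - MvPolynomial.X 0 ^ (d + 1)) ^ (b d)) fun y hy => ?_).congr
    fun y _ => ?_
  · simp only [map_prod, map_pow, map_sub, map_one, MvPolynomial.aeval_X]
    refine Finset.prod_ne_zero_iff.2 fun d _ => pow_ne_zero _ ?_
    have h1 : y 0 ^ (d + 1) < 1 := pow_lt_one₀ hy.1.le hy.2 d.succ_ne_zero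
    exact (sub_pos.2 h1).ne'
  · simp only [map_prod, map_pow, map_sum, map_sub, map_one, MvPolynomial.aeval_X]
    rw [← Finset.prod_div_distrib]
    refine Finset.prod_congr rfl fun d _ => ?_
    rw [one_div_pow, mul_one_div]

/-! ## The lower bound `F ≥ 1` on `(0,1)` -/

/-- On `(0,1)` every factor of the cyclotomic edge is `≥ 1` (`G_{d+1} = 1 + x (⋯) ≥ 1`,
`H_{d+1} = 1/(1 − x^{d+1}) ≥ 1`), hence so is the edge. [folklore] -/
private theorem one_le_cycloEdge (n : ℕ) (a b : ℕ → ℕ) {x : ℝ} (hx : x ∈ Set.Ioo (0:ℝ) 1) :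
    1 ≤ ∏ d ∈ Finset.range n,
        (∑ i ∈ Finset.range (d + 1), x ^ i) ^ (a d) * (1 / (1 - x ^ (d + 1))) ^ (b d) := by
  refine Finset.one_le_prod fun d _ =>
    one_le_mul_of_one_le_of_one_le (one_le_pow₀ ?_) (one_le_pow₀ ?_)
  · rw [Finset.sum_range_succ', pow_zero]
    have h0 : 0 ≤ ∑ i ∈ Finset.range d, x ^ (i + 1) :=
      Finset.sum_nonneg fun i _ => pow_nonneg hx.1.le _
    linarith
  · have h1 : x ^ (d + 1) < 1 := pow_lt_one₀ hx.1.le hx.2 d.succ_ne_zero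
    rw [le_div_iff₀ (sub_pos.2 h1)]
    linarith [pow_nonneg hx.1.le (d + 1)]

/-! ## Integrability of `(c/x) log F` on `(0,1)` -/

/-- On `(0,1)`: `log G_{d+1} = log (1/(1−x)) − log (1/(1−x^{d+1}))`, since
`G_{d+1} (1 − x) = 1 − x^{d+1}` (`geom_sum_mul_neg`). [folklore] -/
private theorem log_geomSum_eq {x : ℝ} (hx : x ∈ Set.Ioo (0:ℝ) 1) (d : ℕ) :
    Real.log (∑ i ∈ Finset.range (d + 1), x ^ i) =
      Real.log (1 / (1 - x)) - Real.log (1 / (1 - x ^ (d + 1))) := by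
  have h1 : 0 < 1 - x := sub_pos.2 hx.2
  have h2 : 0 < 1 - x ^ (d + 1) := sub_pos.2 (pow_lt_one₀ hx.1.le hx.2 d.succ_ne_zero)
  have hG : ∑ i ∈ Finset.range (d + 1), x ^ i = (1 - x ^ (d + 1)) / (1 - x) := by
    rw [eq_div_iff h1.ne', geom_sum_mul_neg]
  rw [hG, Real.log_div h2.ne' h1.ne', one_div, Real.log_inv, one_div, Real.log_inv]
  ring

/-- On `(0,1)` the logarithm of the cyclotomic edge is the finite `ℕ`-combination
`∑_{d<n} (a d · (log (1/(1−x)) − log (1/(1−x^{d+1}))) + b d · log (1/(1−x^{d+1})))`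
(`Real.log_prod`, `Real.log_mul`, `Real.log_pow` on positive factors, and `log_geomSum_eq`).
[folklore] -/
private theorem log_cycloEdge_eq (n : ℕ) (a b : ℕ → ℕ) {x : ℝ} (hx : x ∈ Set.Ioo (0:ℝ) 1) :
    Real.log (∏ d ∈ Finset.range n,
        (∑ i ∈ Finset.range (d + 1), x ^ i) ^ (a d) * (1 / (1 - x ^ (d + 1))) ^ (b d)) =
      ∑ d ∈ Finset.range n,
        ((a d : ℝ) * (Real.log (1 / (1 - x)) - Real.log (1 / (1 - x ^ (d + 1)))) +
          (b d : ℝ) * Real.log (1 / (1 - x ^ (d + 1)))) := by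
  have hG0 : ∀ d : ℕ, 0 < ∑ i ∈ Finset.range (d + 1), x ^ i := fun d =>
    Finset.sum_pos (fun i _ => pow_pos hx.1 i) Finset.nonempty_range_add_one
  have hH0 : ∀ d : ℕ, 0 < 1 / (1 - x ^ (d + 1)) := fun d =>
    one_div_pos.2 (sub_pos.2 (pow_lt_one₀ hx.1.le hx.2 d.succ_ne_zero))
  rw [Real.log_prod fun d _ => (mul_pos (pow_pos (hG0 d) _) (pow_pos (hH0 d) _)).ne']
  refine Finset.sum_congr rfl fun d _ => ?_
  rw [Real.log_mul (pow_pos (hG0 d) _).ne' (pow_pos (hH0 d) _).ne', Real.log_pow, Real.log_pow,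
    log_geomSum_eq hx d]

/-- For every real `c`, `(c/x) log F` is absolutely integrable on `(0,1)`: by `log_cycloEdge_eq` it
agrees there with a finite `ℕ`-combination of the functions `(c/x) log (1/(1−xᵏ))`, `k ≥ 1`, which
are integrable on `(0,1)` by conjunct 5 of `integrable_logs`. [cite: KontsevichZagier2001, §1.2] -/
private theorem integrableOn_div_mul_log_cycloEdge (n : ℕ) (a b : ℕ → ℕ) (c : ℝ) :
    IntegrableOn (fun x : ℝ => (c / x) * Real.log (∏ d ∈ Finset.range n,
        (∑ i ∈ Finset.range (d + 1), x ^ i) ^ (a d) * (1 / (1 - x ^ (d + 1))) ^ (b d)))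
      (Set.Ioo (0:ℝ) 1) := by
  have hI : ∀ (c : ℝ) (k : ℕ), 1 ≤ k →
      IntegrableOn (fun x : ℝ => (c / x) * Real.log (1 / (1 - x ^ k))) (Set.Ioo (0:ℝ) 1) :=
    integrable_logs.2.2.2.2
  have hI1 : IntegrableOn (fun x : ℝ => (c / x) * Real.log (1 / (1 - x))) (Ioo (0:ℝ) 1) := by
    simpa only [pow_one] using hI c 1 le_rfl
  have hsum : IntegrableOn (fun x : ℝ => ∑ d ∈ Finset.range n,
      ((a d : ℝ) * ((c / x) * Real.log (1 / (1 - x)) - (c / x) * Real.log (1 / (1 - x ^ (d + 1)))) +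
        (b d : ℝ) * ((c / x) * Real.log (1 / (1 - x ^ (d + 1)))))) (Ioo (0:ℝ) 1) := by
    refine integrable_finsetSum (Finset.range n) fun d _ => ?_
    exact ((hI1.sub (hI c (d + 1) (by omega))).const_mul _).add
      ((hI c (d + 1) (by omega)).const_mul _)
  refine hsum.congr_fun (fun x hx => ?_) measurableSet_Ioo
  simp only
  rw [log_cycloEdge_eq n a b hx, Finset.mul_sum]
  refine Finset.sum_congr rfl fun d _ => ?_
  ring

/-! ## The kit -/

/-- **Cyclotomic kit.** For the cyclotomic edge
`F(n,a,b)(x) = ∏_{d<n} G_{d+1}(x)^{a d} · H_{d+1}(x)^{b d}`, `G_{d+1}(x) = ∑_{i≤d} xⁱ`,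
`H_{d+1}(x) = 1/(1 − x^{d+1})`: `F` is `ℚ`-semialgebraic on `(0,1) ⊆ ℝ¹`, `F ≥ 1` on `(0,1)`,
and `(c/x) log F` is absolutely integrable on `(0,1)` for every real `c` — the three side
conditions under which the unfolded log monomial `M(c/x, F) = [{0<x<1, 1 ≤ s ≤ F x}, (c/x)/s]` is
an integral representation of the KZ calculus. [cite: KontsevichZagier2001, §1.2] -/
theorem cyclo_kit (n : ℕ) (a b : ℕ → ℕ) :
    IsSemialgebraicFunOn ℚ {y : Fin 1 → ℝ | 0 < y 0 ∧ y 0 < 1}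
      (fun y => (fun x : ℝ => ∏ d ∈ Finset.range n,
        (∑ i ∈ Finset.range (d + 1), x ^ i) ^ (a d) * (1 / (1 - x ^ (d + 1))) ^ (b d)) (y 0)) ∧
    (∀ x ∈ Set.Ioo (0:ℝ) 1, 1 ≤ ∏ d ∈ Finset.range n,
        (∑ i ∈ Finset.range (d + 1), x ^ i) ^ (a d) * (1 / (1 - x ^ (d + 1))) ^ (b d)) ∧
    (∀ c : ℝ, IntegrableOn (fun x : ℝ => (c / x) * Real.log (∏ d ∈ Finset.range n,
        (∑ i ∈ Finset.range (d + 1), x ^ i) ^ (a d) * (1 / (1 - x ^ (d + 1))) ^ (b d))) (Set.Ioo (0:ℝ) 1)) :=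
  ⟨isSemialgebraicFunOn_cycloEdge n a b, fun _ hx => one_le_cycloEdge n a b hx,
    fun c => integrableOn_div_mul_log_cycloEdge n a b c⟩

end Summit.KontsevichZagierPeriods.HurwitzMicroSectors.NormalFormPrinciple.PiBox.M2
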